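import Summits.Langlands.Langlands.Theses.QuinticX0105Split

/-!
# Route QuinticX0105Split — Assembly

The assembly item (stmt-Langlands-27797) of the child route `QuinticX0105Split` (decomp-langlands lens-5 gen 17; `--refines route-Langlands-EllipticDegreeLadder:QuinticModularity`, edge split, depth 1) for
Q5 = `EllipticDegreeLadder.QuinticModularity` (stmt-Langlands-30187):
`GenericQuinticModularity → QuinticX0105Modularity → QuinticCartanLocusModularity → EllipticDegreeLadder.QuinticModularity`.

This is literally the type of the route file's sorry-free deciding theorem `Summit.Langlands.Langlands.Theses.QuinticX0105Split.closes`.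
Nothing here proves `Langlands` (nor the parent piece): the assembly records only that the three cell items of the route (GQM, XM, CLM), taken together,
imply the parent piece by name.
-/

set_option linter.dupNamespace false -- project-wide option (lakefile weak.linter.dupNamespace); `Summit.Langlands.Langlands` is the mandated namespace

namespace Summit.Langlands.Langlands.Theorems

/-- **Assembly of route QuinticX0105Split** (stmt-Langlands-27797): `GenericQuinticModularity → QuinticX0105Modularity → QuinticCartanLocusModularity → EllipticDegreeLadder.QuinticModularity`.
Proof: unfold `Assembly` and apply the route's deciding theorem `Theses.QuinticX0105Split.closes`. -/
theorem quinticX0105Split_assembly_proof :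
    Summit.Langlands.Langlands.Theses.QuinticX0105Split.Assembly := by
  unfold Summit.Langlands.Langlands.Theses.QuinticX0105Split.Assembly
  exact Summit.Langlands.Langlands.Theses.QuinticX0105Split.closes

end Summit.Langlands.Langlands.Theorems
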